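import Summits.ResolutionOfSingularities.ResolutionOfSingularities.Theorems.FrobeniusClosingPatchingRelPerfectCoreRungConeMember
import Summits.ResolutionOfSingularities.ResolutionOfSingularities.Theorems.FrobeniusClosingPatchingRelPerfectConeMemberLevelTwoIdeals
import Literature.AlgebraicGeometry.Resolution.FormalNodeRingDomain
import HarnessLib

/-!
# Crux `PatchingRelPerfect` (stmt-ResolutionOfSingularities-16161), chain w52 — the quadric cone
# surface `V(u, F)` on the vertex chart is integral and misses no coordinate

[OURS · L1 W5.2 · rung] Inputs of the level-two assembly of the contact-migration member
(`…ConeCubeLevelTwo`, hypotheses `IsDomain (A ⧸ (t, F))` and `v_k ∉ (t, F)`) on the vertex chart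
`B₃ = S[x/x₃]` of `Bl_𝔪 Spec S` (`S` regular local of dimension four, regular system of parameters
`x`, `u = x₃`, `e_j = x_j/x₃`, `F = e₀e₁ + e₂²`): under `B₃/(u) ≅ κ[T₀, T₁, T₂]` the surface
`V(u, F)` is the quadric cone `T₀T₁ + T₂² = 0`, so

* `prime_coneForm` — `T₀T₁ + T₂²` is a prime element of `κ[T_j : j ≠ 3]` (`X_u X_v - M`
  irreducibility, `Literature…MvPolynomial.irreducible_X_mul_X_sub_rename`, and unique factorisation);
* `isDomain_quot_span_u_F_three` — `B₃ ⧸ (u, F)` is a domain;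
* `chartGen_notMem_span_u_F_three` — `e_k ∉ (u, F)` for `k ≤ 2` (evaluate at the cone point
  `(1, -1, 1)`).

Nothing here is a statement of the manuscript under review.

## References

* The Stacks Project, Tag 0BIQ. [StacksProject]
-/

-- `Summit.<Summit>.<Sub>.Theorems` with `Sub = Summit` (single-conjunct summit, D-0017)
set_option linter.dupNamespace false

noncomputable section

open CategoryTheory CategoryTheory.Limits AlgebraicGeometry Literature.AlgebraicGeometry.Resolution
open IsLocalRing

namespace Summit.ResolutionOfSingularities.ResolutionOfSingularities.Theorems

namespace ConeRung

universe u

/-! ## The quadric cone form is prime -/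

/-- **`T₀T₁ + T₂²` is a prime element of `κ[T_j : j ≠ 3]`** for every field `κ`: it is
`X₀ X₁ - M` with `M = -X₂²` not divisible by `X₀`, hence irreducible, hence prime.
[folklore] -/
theorem prime_coneForm (κ : Type u) [Field κ] :
    Prime (MvPolynomial.X ⟨0, zero_ne_three4⟩ * MvPolynomial.X ⟨1, one_ne_three4⟩ +
      MvPolynomial.X ⟨2, two_ne_three4⟩ ^ 2 : MvPolynomial {j : Fin 4 // j ≠ 3} κ) := by
  classical
  set a : {j : Fin 4 // j ≠ 3} := ⟨0, zero_ne_three4⟩ with ha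
  set b : {j : Fin 4 // j ≠ 3} := ⟨1, one_ne_three4⟩ with hb
  set c : {j : Fin 4 // j ≠ 3} := ⟨2, two_ne_three4⟩ with hc
  have hab : a ≠ b := fun h => zero_ne_one4 (congrArg Subtype.val h)
  have hcb : c ≠ b := fun h => one_ne_two4 (congrArg Subtype.val h).symm
  have hac : a ≠ c := fun h => zero_ne_two4 (congrArg Subtype.val h)
  set M₀ : MvPolynomial {d : {j : Fin 4 // j ≠ 3} // d ≠ b} κ :=
    -(MvPolynomial.X ⟨c, hcb⟩ ^ 2) with hM₀
  have hM : ¬ (MvPolynomial.X ⟨a, hab⟩ ∣ M₀) := by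
    intro hd
    have hmem : M₀ ∈ Ideal.span (MvPolynomial.X '' {(⟨a, hab⟩ : {d : {j : Fin 4 // j ≠ 3} // d ≠ b})}) := by
      rw [Set.image_singleton]
      exact Ideal.mem_span_singleton.mpr hd
    rw [MvPolynomial.mem_ideal_span_X_image] at hmem
    have hs : Finsupp.single (⟨c, hcb⟩ : {d : {j : Fin 4 // j ≠ 3} // d ≠ b}) 2 ∈ M₀.support := by
      rw [hM₀, MvPolynomial.X_pow_eq_monomial, ← map_neg, MvPolynomial.support_monomial,
        if_neg (neg_ne_zero.mpr one_ne_zero)]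
      exact Finset.mem_singleton_self _
    obtain ⟨i, hi, hne⟩ := hmem _ hs
    rw [Set.mem_singleton_iff] at hi
    rw [hi, Finsupp.single_apply, if_neg (fun h => hac (congrArg Subtype.val h).symm)] at hne
    exact hne rfl
  have hirr := MvPolynomial.irreducible_X_mul_X_sub_rename a b hab M₀ hM
  have e : MvPolynomial.X a * MvPolynomial.X b - MvPolynomial.rename Subtype.val M₀ =
      MvPolynomial.X a * MvPolynomial.X b + MvPolynomial.X c ^ 2 := by
    rw [hM₀, map_neg, map_pow, MvPolynomial.rename_X, sub_neg_eq_add]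
  rw [e] at hirr
  exact UniqueFactorizationMonoid.irreducible_iff_prime.mp hirr

section VertexChart

variable {S : Type u} [CommRing S] [IsRegularLocalRing S] (x : Fin 4 → S)
  (hx : Ideal.span (Set.range x) = IsLocalRing.maximalIdeal S)
  (hd : (IsLocalRing.maximalIdeal S).spanFinrank = 4)

local notation3 "M" => Ideal.span (Set.range x)

include hx hd in
/-- **`B₃ ⧸ (u, F)` is a domain** (`≅ κ[T₀, T₁, T₂]/(T₀T₁ + T₂²)`, the quadric cone).
[cite: StacksProject, Tag 0BIQ] -/
theorem isDomain_quot_span_u_F_three :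
    IsDomain (chartRing x 3 ⧸ Ideal.span {chartBase x 3 (x 3),
      chartGen x 3 0 * chartGen x 3 1 + chartGen x 3 2 ^ 2}) := by
  haveI := isMaximal_span_rsop x hx
  letI := Ideal.Quotient.field (M)
  have hqr := isQuasiRegular_regularSystemOfParameters hd x hx
  set F₀ : MvPolynomial {j : Fin 4 // j ≠ 3} (S ⧸ M) :=
    MvPolynomial.X ⟨0, zero_ne_three4⟩ * MvPolynomial.X ⟨1, one_ne_three4⟩ +
      MvPolynomial.X ⟨2, two_ne_three4⟩ ^ 2 with hF₀def
  have hF₀ : chartQuotEquiv x 3 hqr F₀ = Ideal.Quotient.mk _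
      (chartGen x 3 0 * chartGen x 3 1 + chartGen x 3 2 ^ 2) := by
    rw [hF₀def, chartQuotEquiv_apply, map_add, map_mul, map_pow, chartQuotMap_X, chartQuotMap_X,
      chartQuotMap_X, ← map_mul, ← map_pow, ← map_add]
  have hprime : Prime F₀ := prime_coneForm (S ⧸ M)
  haveI : IsDomain (MvPolynomial {j : Fin 4 // j ≠ 3} (S ⧸ M) ⧸ Ideal.span {F₀}) :=
    (Ideal.Quotient.isDomain_iff_prime _).mpr ((Ideal.span_singleton_prime hprime.ne_zero).mpr hprime)
  obtain ⟨eq, -⟩ := exists_quotient_equiv_sup_span _ (chartQuotEquiv x 3 hqr) F₀ _ hF₀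
  exact MulEquiv.isDomain (MvPolynomial {j : Fin 4 // j ≠ 3} (S ⧸ M) ⧸ Ideal.span {F₀})
    ((Ideal.quotEquivOfEq (Ideal.span_insert _ _)).trans eq.symm).toMulEquiv

include hx hd in
/-- **`e_k ∉ (u, F)` for `k ≤ 2`**: evaluate at the `κ`-point `(T₀, T₁, T₂) = (1, -1, 1)` of the
cone, where `e_k ↦ ±1 ≠ 0`. [cite: StacksProject, Tag 0BIQ] -/
theorem chartGen_notMem_span_u_F_three (k : Fin 3) :
    chartGen x 3 (Fin.castSucc k) ∉ Ideal.span {chartBase x 3 (x 3),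
      chartGen x 3 0 * chartGen x 3 1 + chartGen x 3 2 ^ 2} := by
  haveI := isMaximal_span_rsop x hx
  letI := Ideal.Quotient.field (M)
  have hqr := isQuasiRegular_regularSystemOfParameters hd x hx
  set ε := chartQuotEquiv x 3 hqr with hε
  set pt : {j : Fin 4 // j ≠ 3} → S ⧸ M := fun j => if j.1 = 1 then -1 else 1 with hpt
  set θ : (chartRing x 3 ⧸ Ideal.span {chartBase x 3 (x 3)}) →+* S ⧸ M :=
    (MvPolynomial.eval pt).comp ε.symm.toRingHom with hθ
  have hθdef : ∀ z, θ z = MvPolynomial.eval pt (ε.symm z) := fun z => rfl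
  have hθX : ∀ (j : Fin 4) (hj : j ≠ 3),
      θ (Ideal.Quotient.mk _ (chartGen x 3 j)) = if j = 1 then -1 else 1 := fun j hj => by
    have h1 : ε.symm (Ideal.Quotient.mk _ (chartGen x 3 j)) = MvPolynomial.X ⟨j, hj⟩ := by
      rw [RingEquiv.symm_apply_eq, hε, chartQuotEquiv_apply, chartQuotMap_X]
    rw [hθdef, h1, MvPolynomial.eval_X]
  set Θ : chartRing x 3 →+* S ⧸ M := θ.comp (Ideal.Quotient.mk _) with hΘ
  have hΘX : ∀ (j : Fin 4) (hj : j ≠ 3), Θ (chartGen x 3 j) = if j = 1 then -1 else 1 :=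
    fun j hj => hθX j hj
  have hΘu : Θ (chartBase x 3 (x 3)) = 0 := by
    rw [hΘ, RingHom.comp_apply, Ideal.Quotient.eq_zero_iff_mem.mpr (Ideal.mem_span_singleton_self _),
      map_zero]
  intro hmem
  obtain ⟨a, b, hab⟩ := Ideal.mem_span_pair.mp hmem
  have h := congrArg Θ hab
  simp only [map_add, map_mul, map_pow] at h
  rw [hΘu, hΘX 0 zero_ne_three4, hΘX 1 one_ne_three4, hΘX 2 two_ne_three4, if_neg zero_ne_one4,
    if_pos rfl, if_neg (fun h => one_ne_two4 h.symm), hΘX _ (castSucc_ne_three k)] at h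
  have e0 : (1 : S ⧸ M) * -1 + 1 ^ 2 = 0 := by ring
  rw [e0, mul_zero, mul_zero, add_zero] at h
  have h1 : ((if Fin.castSucc k = 1 then -1 else 1 : S ⧸ M)) ≠ 0 := by
    split_ifs
    · exact neg_ne_zero.mpr one_ne_zero
    · exact one_ne_zero
  exact h1 h.symm

end VertexChart

end ConeRung

end Summit.ResolutionOfSingularities.ResolutionOfSingularities.Theorems

end
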